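/-
Copyright (c) 2026. All rights reserved.
Released under Apache 2.0 license as described in the file LICENSE.
-/
import Literature.AlgebraicGeometry.ComplexMultiplication.DihedralSexticPairWeights
import Literature.AlgebraicGeometry.ComplexMultiplication.CMWeilSectionWeilTypeOfMarkman
import Literature.AlgebraicGeometry.Pohlmann1968.CorankOneCMTypeWeilType
import Literature.AlgebraicGeometry.Pohlmann1968.CMFamilyRankSubfamilies
import Literature.AlgebraicGeometry.HodgeTheory.WeilClassesFieldIntersections
import HarnessLib

/-!
# Products `⨁_i A_i` of CM abelian varieties whose FAMILY of CM types has Kubota corank `≤ 1` and a balanced transversal: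
# the balanced weights are the divisor weights and the two Weil fibres — `B• = D• ⊕ W_k` (any number of factors, any dimension)

Topic `Literature/AlgebraicGeometry/Pohlmann1968`, namespace `Pohlmann1968.CMAlgebra.CorankOne`; the CM-ALGEBRA form of
`Pohlmann1968/CorankOneCMTypeWeilType` (there: ONE CM field `K`, a PRIMITIVE type of corank `≤ 1`; here: a CM algebra `∏_{i<n} K_i`,
Deligne's type `Σ = ⊔_i {i} × Φ_i`, and products of realisations with DIFFERENT CM fields — e.g. a CM elliptic curve times a
simple CM abelian variety of odd dimension, Moonen–Zarhin's case (a)).  KERNEL ONLY: theorems, no definition, no named fact, no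
`sorry`, no instance (D-0014/D-0026).  Cell `pub-hodgecm2` (COR-CM), KEPT Literature lane `lit-deligne-3` (generation 56, file F51a).
Nothing here asserts the algebraicity of any class; HC_CM is NOT proved.

## The print

* B. Moonen, Yu. Zarhin, *Hodge classes on abelian varieties of low dimension*, Math. Ann. 315 (1999) [MoonenZarhin1999LowDim]
  (held `paper:arxiv-math_9901113`, p. 1): Thm. 0.1 «Let `X` be a complex abelian fourfold with `dim_ℚ B²(X) > dim_ℚ D²(X)` […]
  (a) `X` is isogenous to a product `X₁ × X₂` where `X₁` is an elliptic curve with complex multiplication by an imaginary quadratic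
  field `k` and where `X₂` is a simple abelian threefold such that there exists an embedding `k ↪ End⁰(X₂)` […] (1) Suppose we are in
  case (a) or (b). Then the Hodge ring `B•(X)` is generated by the subalgebra `D•(X)` of divisor classes together with the space of
  Weil classes `W_k ⊂ B²(X)` […] in these cases we have `D²(X) ≠ B²(X)`»; §1 (1.4), (1.9) (Weil classes of `k ↪ End⁰(X)`).
* B. van Geemen, LNM 1594 (1994) [vanGeemen1994HodgeAV], 4.7, 4.9–4.10 (Weil type, `W_K = ⋀^{2n}_K H¹`), Thm. 6.12 (Weil 1977:
  «`Bᵖ(X) = Dᵖ` for `p ≠ n`, `Bⁿ(X) = Dⁿ ⊕ ⋀_K^{2n} H¹(X, ℚ)`»).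
* P. Deligne, LNM 900 (1982) [Deligne1982HodgeCycles], I Ex. 3.7 (the CM algebra `E = ∏ K_i`, its type `Σ`, `rank Y(MT(∏ A_i))`),
  §4 Prop. 4.4; B. B. Gordon [Gordon1999HodgeAVSurvey] 7.4–7.7 (`rank Hg(A) ≤ rdim A`), 9.1/9.4 (rank, degenerate types), §9.2
  (9.2.1)–9.2.2 (Pohlmann's condition; divisor weights = disjoint unions of balanced pairs), 9.5 (André: Hodge classes of CM type are
  generated by Weil classes), 5.13; T. Kubota 1965 [Kubota1965] §2 (rank and defect); Z. Gao, E. Ullmo [GaoUllmo2025] Thm. 3.1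
  (Pohlmann's theorem for a CM algebra; tree THEOREM `Pohlmann1968_thm1_cmAlgebra`); J. S. Milne 2020 [Milne2020HodgeClassesAV] 1.2, Thm. 1.

## What is proved (`K : Fin n → Type` CM fields, `Φ_i` CM types, index set `E = ⊔_i Hom(K_i, ℂ)` with its `Aut(ℂ)`-action,
## `ρ` = complex conjugation; realisations `A_i ⊨ (K_i; Φ_i)` read on `H¹`; `T ⊆ E` a TRANSVERSAL — `x ∈ T ↔ ρx ∉ T` — satisfying
## Pohlmann's condition; corank `≤ 1`: `(Σ_i [K_i:ℚ])/2 ≤ cmFamilyRank Φ`, i.e. `dim MT(∏ A_i) ≥ dim ∏ A_i`)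

* §1 bookkeeping: `isGaloisBalancedAlg_iff_isBalanced_indicator` (Pohlmann's condition on a SET is `IsBalanced` of its indicator); `smul_mem_pohlmannSetsAlg`, `smul_mem_pohlmannDivisorSetsAlg` (`Aut(ℂ)` permutes
  balanced sets and divisor sets); `card_sigma_eq_sum_finrank`.
* §2 **`mem_pohlmannDivisorSetsAlg_or_eq_or_eq_conj_smul`** — THE CLASSIFICATION: every balanced weight `S ∈ pohlmannSetsAlg Φ q` is a
  disjoint union of conjugate pairs, or `S = T`, or `S = ρ • T` (Kubota's defect count through the tree's
  `exists_sub_rho_smul_eq_const_of_isBalanced`: `𝟙_S − 𝟙_S ∘ ρ` is constant `∈ {−1, 0, 1}` along `T`).  Corollaries: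
  `pohlmannSetsAlg_subset_pohlmannDivisorSetsAlg_of_ne` (`B^q = D^q` on index sets for `4q ≠ Σ_i [K_i:ℚ]`), `two_mul_card_eq_sum_finrank`
  (`2|T| = Σ_i [K_i:ℚ]`), **`smul_eq_or_eq_conj_smul_of_not_mem`** (if `T` is not a divisor set then `τ • T ∈ {T, ρ • T}` for every
  `τ ∈ Aut(ℂ)` — `T` is a WEIL SECTION), `conj_smul_not_mem_pohlmannDivisorSetsAlg`, `mem_pohlmannSetsAlg_diff_iff` (the exceptional sets are
  EXACTLY `T, ρ • T`), `ncard_pohlmannSetsAlg_diff_eq_two`.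
* §3 the WEIL FIBRE of a diagonal square root `a ∈ ∏_i 𝓞_{K_i}`, `a_i² = −d`, `d ≥ 1`:
  `T_a = {(i, s) : s(a_i) = i√d}` (written `Finset.univ.filter …`): `apply_eq_or_eq_neg` (every `s(a_i) = ± i√d`),
  `mem_weilFibre_iff_conj_smul_not_mem` (a transversal), `smul_weilFibre_eq_or` (Galois moves it to itself or to its conjugate),
  **`isGaloisBalancedAlg_of_smul_eq_or`** (a Weil section is balanced as soon as `#(T ∩ Σ) = #(T ∖ Σ)` — ONE count: «`k` acts with
  multiplicities `(m, m)`»), `conj_smul_weilFibre_eq`.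
* §4 geometry for realisations, `φ_a = ⊕_i ι_i(a_i)` (`φ_a² = −d`): **`hodgeClassSpan_eq_divisorClassesSpan_of_ne`** (`B^q(⨁A) ⊗ ℂ = D^q ⊗ ℂ`
  off the middle degree), **`hodgeClassSpan_eq_divisorClassesSpan_sup_weilClassesOf`** (`B^m ⊗ ℂ = D^m ⊗ ℂ ⊔ W_k ⊗ ℂ`, `4m = Σ_i [K_i:ℚ]`),
  **`isWeilType`** (`(⨁ A, φ_a)` is of WEIL TYPE `(m, d)`), `isDivisorWeilGenerated`, `exists_exceptional` and `not_isDivisorGenerated`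
  (`B^m ≠ D^m`), **`hodgeConjectureFor_of_weilClasses_algebraic`** (the Hodge conjecture for `⨁ A` follows from the algebraicity of the rational
  `(m,m)` classes of the ONE Weil plane of `φ_a`), and for two factors `hodgeConjectureFor_prod_of_weilClasses_algebraic` (`A₀ × A₁`).

Moonen–Zarhin's Thm. 0.1 (1) is the case `n = 2`, `K₀ = k` imaginary quadratic, `K₁` sextic, `m = 2`; the tree's
`CMWeights.moonenZarhin_codimTwo_biproduct_cm` has `B² ⊆ D² + Σ W` for every CM-product fourfold; this file gives the EQUALITY with ONE
Weil plane and all degrees, in every dimension, under the corank hypothesis.  Consumers: this lane's F51b (`E_i × Y_{4p}`, `p ≡ 3 (mod 4)`,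
an infinite family of dimension `(p+1)/2`).

## References
* [MoonenZarhin1999LowDim] B. Moonen, Yu. Zarhin, Math. Ann. 315 (1999) 711–733: Thm. 0.1 (a), (1); §1 (1.4), (1.9).
* [vanGeemen1994HodgeAV] B. van Geemen, LNM 1594 (1994): 4.7, 4.9–4.10, Lemma 5.2, Thm. 6.12.
* [Deligne1982HodgeCycles] P. Deligne, LNM 900 (1982): I Ex. 3.7, §4 Prop. 4.4.
* [Gordon1999HodgeAVSurvey] B. B. Gordon (1999): 5.13, Thm. 6.4, 7.4–7.7, 9.1, §9.2 (9.2.1), 9.2.2, 9.4, 9.5.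
* [Kubota1965] T. Kubota, Trans. AMS 118 (1965): §2.
* [GaoUllmo2025] Z. Gao, E. Ullmo, J. Inst. Math. Jussieu 25 (2025): Thm. 3.1.
* [Milne2020HodgeClassesAV] J. S. Milne (2020): 1.2 (a), (c), Thm. 1.
* [Pohlmann1968] H. Pohlmann, Ann. of Math. 88 (1968): Thm. 1.
* [Shimura1998] G. Shimura, *Abelian Varieties with Complex Multiplication and Modular Functions* (1998): §18.1 (CM types as transversals).
-/

noncomputable section

open CategoryTheory CategoryTheory.Limits NumberField Module

namespace Literature.AlgebraicGeometry.Pohlmann1968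

namespace CMAlgebra

namespace CorankOne

open Literature.NumberTheory.ComplexMultiplication
open Literature.AlgebraicGeometry.Motives (AbelianVariety CMType IsSmoothProjective)
open Literature.AlgebraicGeometry.HodgeTheory
open Literature.AlgebraicGeometry.ComplexMultiplication (IsCMTypeRealisation)
open Literature.AlgebraicGeometry.ComplexMultiplication.CMWeights
open Literature.AlgebraicGeometry.ComplexMultiplication.PairWeights
open Literature.AlgebraicGeometry.VanGeemen1994 (hodgeClassSpan)
open Literature.Barriers.HodgeConjecture (divisorClassesSpan)

open scoped Classical Pointwise

/-! ## §1 Bookkeeping: Pohlmann's condition on a set as a balanced indicator; `Aut(ℂ)` permutes balanced and divisor sets -/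

section Bookkeeping

variable {n : ℕ} {K : Fin n → Type} [∀ i, Field (K i)] [∀ i, NumberField (K i)]

/-- `|⊔_i Hom(K_i, ℂ)| = Σ_i [K_i:ℚ]`. [folklore] -/
private theorem card_sigma_eq_sum_finrank : Fintype.card ((i : Fin n) × (K i →+* ℂ)) = ∑ i, finrank ℚ (K i) := by
  rw [Fintype.card_sigma]
  exact Finset.sum_congr rfl fun i _ => Embeddings.card (K i) ℂ

omit [∀ i, NumberField (K i)] in
/-- A separated count over a Finset is the cardinality of a filter (the counts `|σP ∩ Φ|` of condition (3.2)). [cite: GaoUllmo2025, Thm. 3.1 (3.2)] -/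
theorem ncard_sep_eq_card_filter (S : Finset ((i : Fin n) × (K i →+* ℂ))) (Q : (i : Fin n) × (K i →+* ℂ) → Prop) :
    {x | x ∈ S ∧ Q x}.ncard = (S.filter Q).card := by
  rw [show {x | x ∈ S ∧ Q x} = ↑(S.filter Q) by ext x; simp only [Set.mem_setOf_eq, Finset.coe_filter],
    Set.ncard_coe_finset]

/-- **Pohlmann's condition (9.2.1) on a subset `S ⊆ ⊔_i Hom(K_i, ℂ)` is `IsBalanced` of its indicator** for the `Aut(ℂ)`-set
`⊔_i Hom(K_i, ℂ)` and Deligne's type `Σ` (`2 · #{x ∈ S : τx ∈ Σ} = |S|` for every `τ`).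
[cite: Gordon1999HodgeAVSurvey, §9.2 (9.2.1)] [cite: Deligne1982HodgeCycles, I Ex. 3.7 (c)] -/
theorem isGaloisBalancedAlg_iff_isBalanced_indicator (Φ : ∀ i, CMType (K i)) (S : Finset ((i : Fin n) × (K i →+* ℂ))) :
    IsGaloisBalancedAlg Φ S ↔
      IsBalanced (ℂ ≃+* ℂ) (familyType Φ) (fun y => if y ∈ S then (1 : ℚ) else 0) := by
  refine forall_congr' fun τ => ?_
  have h1 : ∑ x, (if x ∈ S then (1 : ℚ) else 0) * translateInd (familyType Φ) τ x =
      ((S.filter fun x => (τ : ℂ →+* ℂ).comp x.2 ∈ (Φ x.1).1).card : ℚ) := by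
    have e : ∀ x : (i : Fin n) × (K i →+* ℂ), (if x ∈ S then (1 : ℚ) else 0) * translateInd (familyType Φ) τ x =
        if x ∈ S then (if (τ : ℂ →+* ℂ).comp x.2 ∈ (Φ x.1).1 then (1 : ℚ) else 0) else 0 := by
      intro x
      by_cases hx : x ∈ S
      · rw [if_pos hx, if_pos hx, one_mul]
        by_cases hq : (τ : ℂ →+* ℂ).comp x.2 ∈ (Φ x.1).1
        · rw [if_pos hq, translateInd_of_mem ((smul_mem_familyType_iff Φ τ x).2 hq)]
        · rw [if_neg hq, translateInd_of_not_mem (fun h => hq ((smul_mem_familyType_iff Φ τ x).1 h))]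
      · rw [if_neg hx, if_neg hx, zero_mul]
    rw [Finset.sum_congr rfl fun x _ => e x, Finset.sum_ite_mem, Finset.univ_inter, Finset.sum_boole]
  have h2 : ∑ x, (if x ∈ S then (1 : ℚ) else 0) = (S.card : ℚ) := by
    rw [Finset.sum_ite_mem, Finset.univ_inter, Finset.sum_const, nsmul_eq_mul, mul_one]
  -- the partition `S = {τx ∈ Σ} ⊔ {τx ∉ Σ}`
  have h3 : {x | x ∈ S ∧ (τ : ℂ →+* ℂ).comp x.2 ∈ (Φ x.1).1}.ncard +
      {x | x ∈ S ∧ (τ : ℂ →+* ℂ).comp x.2 ∉ (Φ x.1).1}.ncard = S.card := by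
    have hdisj : Disjoint {x | x ∈ S ∧ (τ : ℂ →+* ℂ).comp x.2 ∈ (Φ x.1).1}
        {x | x ∈ S ∧ (τ : ℂ →+* ℂ).comp x.2 ∉ (Φ x.1).1} :=
      Set.disjoint_left.mpr fun x hx hx' => hx'.2 hx.2
    have hunion : {x | x ∈ S ∧ (τ : ℂ →+* ℂ).comp x.2 ∈ (Φ x.1).1} ∪
        {x | x ∈ S ∧ (τ : ℂ →+* ℂ).comp x.2 ∉ (Φ x.1).1} = (S : Set ((i : Fin n) × (K i →+* ℂ))) := by
      ext x
      simp only [Set.mem_union, Set.mem_setOf_eq, Finset.mem_coe]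
      tauto
    have hfin₁ : {x | x ∈ S ∧ (τ : ℂ →+* ℂ).comp x.2 ∈ (Φ x.1).1}.Finite := S.finite_toSet.subset fun x hx => hx.1
    have hfin₂ : {x | x ∈ S ∧ (τ : ℂ →+* ℂ).comp x.2 ∉ (Φ x.1).1}.Finite := S.finite_toSet.subset fun x hx => hx.1
    rw [← Set.ncard_union_eq hdisj hfin₁ hfin₂, hunion, Set.ncard_coe_finset]
  rw [h1, h2, ← ncard_sep_eq_card_filter]
  constructor
  · intro h
    have h' : 2 * {x | x ∈ S ∧ (τ : ℂ →+* ℂ).comp x.2 ∈ (Φ x.1).1}.ncard = S.card := by omega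
    exact_mod_cast h'
  · intro h
    have h' : 2 * {x | x ∈ S ∧ (τ : ℂ →+* ℂ).comp x.2 ∈ (Φ x.1).1}.ncard = S.card := by exact_mod_cast h
    omega

omit [∀ i, NumberField (K i)] in
/-- `|τ • S| = |S|` (`Aut(ℂ)` permutes `𝒫(S)` in condition (3.2)). [cite: GaoUllmo2025, Thm. 3.1 (3.2)] -/
theorem card_smul_eq (τ : ℂ ≃+* ℂ) (S : Finset ((i : Fin n) × (K i →+* ℂ))) : (τ • S).card = S.card :=
  Finset.card_smul_finset τ S

omit [∀ i, NumberField (K i)] in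
/-- **`Aut(ℂ)` permutes the balanced `2q`-sets.** [cite: GaoUllmo2025, Thm. 3.1 (3.2)] -/
private theorem smul_mem_pohlmannSetsAlg {Φ : ∀ i, CMType (K i)} {q : ℕ} {S : Finset ((i : Fin n) × (K i →+* ℂ))}
    (hS : S ∈ pohlmannSetsAlg Φ q) (τ : ℂ ≃+* ℂ) : τ • S ∈ pohlmannSetsAlg Φ q :=
  ⟨by rw [card_smul_eq, hS.1], isGaloisBalancedAlg_smul hS.2 τ⟩

omit [∀ i, NumberField (K i)] in
/-- `τ • (s ⊔ t) = τ • s ⊔ τ • t` with disjointness preserved. [folklore] -/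
private theorem smul_finset_disjUnion (τ : ℂ ≃+* ℂ) {s t : Finset ((i : Fin n) × (K i →+* ℂ))} (h : Disjoint s t) :
    ∃ h' : Disjoint (τ • s) (τ • t), τ • s.disjUnion t h = (τ • s).disjUnion (τ • t) h' := by
  have h' : Disjoint (τ • s) (τ • t) := by
    rw [Finset.disjoint_left]
    intro x hxs hxt
    obtain ⟨y, hy, rfl⟩ := Finset.mem_smul_finset.1 hxs
    obtain ⟨z, hz, hzy⟩ := Finset.mem_smul_finset.1 hxt
    rw [MulAction.injective τ hzy] at hz
    exact Finset.disjoint_left.1 h hy hz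
  refine ⟨h', ?_⟩
  rw [Finset.disjUnion_eq_union, Finset.disjUnion_eq_union, Finset.smul_finset_union]

omit [∀ i, NumberField (K i)] in
/-- **`Aut(ℂ)` permutes the divisor sets** (disjoint unions of balanced pairs go to disjoint unions of balanced pairs).
[cite: Gordon1999HodgeAVSurvey, 9.2.2] -/
theorem smul_mem_pohlmannDivisorSetsAlg {Φ : ∀ i, CMType (K i)} (τ : ℂ ≃+* ℂ) :
    ∀ {q : ℕ} {S : Finset ((i : Fin n) × (K i →+* ℂ))}, S ∈ pohlmannDivisorSetsAlg Φ q → τ • S ∈ pohlmannDivisorSetsAlg Φ q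
  | 0, S, hS => by
    rw [pohlmannDivisorSetsAlg_def, mem_disjointUnionsOf_zero] at hS ⊢
    rw [hS, Finset.smul_finset_empty]
  | q + 1, S, hS => by
    rw [pohlmannDivisorSetsAlg_def, mem_disjointUnionsOf_succ] at hS
    obtain ⟨s, hs, t, ht, hst, rfl⟩ := hS
    obtain ⟨h', he⟩ := smul_finset_disjUnion τ hst
    rw [he, pohlmannDivisorSetsAlg_def, mem_disjointUnionsOf_succ]
    exact ⟨τ • s, (pohlmannDivisorSetsAlg_def Φ q) ▸ smul_mem_pohlmannDivisorSetsAlg τ ((pohlmannDivisorSetsAlg_def Φ q) ▸ hs),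
      τ • t, smul_mem_pohlmannSetsAlg ht τ, h', rfl⟩

omit [∀ i, NumberField (K i)] in
/-- `τ⁻¹ • τ • S = S`. [folklore] -/
private theorem inv_smul_smul_finset (τ : ℂ ≃+* ℂ) (S : Finset ((i : Fin n) × (K i →+* ℂ))) : τ⁻¹ • τ • S = S :=
  inv_smul_smul τ S

omit [∀ i, NumberField (K i)] in
/-- `x ∈ ρ • S ↔ ρ • x ∈ S` (complex conjugation `ι` is an involution on `S = Hom(E, ℂ)`, «`ι ∘ σ = σ ∘ ι_E`»). [cite: Deligne1982HodgeCycles, I Ex. 3.7 (p. 25)] -/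
theorem mem_conj_smul_finset_iff (S : Finset ((i : Fin n) × (K i →+* ℂ))) (x : (i : Fin n) × (K i →+* ℂ)) :
    x ∈ (starRingAut : ℂ ≃+* ℂ) • S ↔ (starRingAut : ℂ ≃+* ℂ) • x ∈ S := by
  constructor
  · intro hx
    obtain ⟨y, hy, rfl⟩ := Finset.mem_smul_finset.1 hx
    rwa [conj_smul_conj_smul]
  · intro hx
    have := Finset.smul_mem_smul_finset (a := (starRingAut : ℂ ≃+* ℂ)) hx
    rwa [conj_smul_conj_smul] at this

end Bookkeeping

/-! ## §2 The classification of the balanced weights of a corank-`≤ 1` family with a balanced transversal -/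

section Classification

variable {n : ℕ} {K : Fin n → Type} [∀ i, Field (K i)] [∀ i, NumberField (K i)] [∀ i, IsCMField (K i)]
  {Φ : ∀ i, CMType (K i)}

/-- **THE CLASSIFICATION.**  Let `(Φ_i)_{i<n}` be CM types of CM fields `K_i` whose family has Kubota corank `≤ 1`
(`(Σ_i [K_i:ℚ])/2 ≤ cmFamilyRank Φ`: `dim MT(∏_i A_i) ≥ dim ∏_i A_i`), and let `T ⊆ ⊔_i Hom(K_i, ℂ)` be a TRANSVERSAL (`x ∈ T ↔ x̄ ∉ T`)
satisfying Pohlmann's condition.  Then every `S ∈ pohlmannSetsAlg Φ q` (a balanced `2q`-set — the index of a line of `B^q(⨁ A_i) ⊗ ℂ`)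
is a disjoint union of conjugate pairs (a DIVISOR weight), or `S = T`, or `S = T̄`.  Proof: `𝟙_S − 𝟙_S ∘ ρ` is balanced and
anti-invariant, hence (Kubota's defect count `rank + dim ≤ |E|/2 + 1`, the tree's `exists_sub_rho_smul_eq_const_of_isBalanced`) a
CONSTANT multiple `c ∈ {−1, 0, 1}` of `𝟙_T − 𝟙_T̄` along `T`; `c = 0` means `S` is conjugation-stable (`PairWeights.mem_pohlmannDivisorSetsAlg_of_conj_smul_mem`),
`c = ±1` means `S = T` resp. `S = T̄`. [cite: Kubota1965, §2 (p. 115)] [cite: Gordon1999HodgeAVSurvey, §9.2 (9.2.1), 9.2.2 and 9.4]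
[cite: MoonenZarhin1999LowDim, Thm. 0.1 (1)] -/
theorem mem_pohlmannDivisorSetsAlg_or_eq_or_eq_conj_smul (hrank : (∑ i, finrank ℚ (K i)) / 2 ≤ cmFamilyRank Φ)
    {T : Finset ((i : Fin n) × (K i →+* ℂ))} (hT : ∀ x, x ∈ T ↔ (starRingAut : ℂ ≃+* ℂ) • x ∉ T)
    (hTbal : IsGaloisBalancedAlg Φ T) {q : ℕ} {S : Finset ((i : Fin n) × (K i →+* ℂ))} (hS : S ∈ pohlmannSetsAlg Φ q) :
    S ∈ pohlmannDivisorSetsAlg Φ q ∨ S = T ∨ S = (starRingAut : ℂ ≃+* ℂ) • T := by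
  set ρ : ℂ ≃+* ℂ := starRingAut with hρ
  have h := isCMTypeWith_familyType Φ
  have hrank' : Fintype.card ((i : Fin n) × (K i →+* ℂ)) / 2 ≤ typeRank (ℂ ≃+* ℂ) (familyType Φ) := by
    rw [card_sigma_eq_sum_finrank]; exact hrank
  have hΨ : ∀ x, x ∈ (↑T : Set ((i : Fin n) × (K i →+* ℂ))) ↔ ρ • x ∉ (↑T : Set ((i : Fin n) × (K i →+* ℂ))) :=
    fun x => by rw [Finset.mem_coe, Finset.mem_coe]; exact hT x
  have hind : (↑T : Set ((i : Fin n) × (K i →+* ℂ))).indicator (1 : ((i : Fin n) × (K i →+* ℂ)) → ℚ) =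
      fun y => if y ∈ T then (1 : ℚ) else 0 := by
    funext y
    by_cases hy : y ∈ T
    · rw [Set.indicator_of_mem (Finset.mem_coe.2 hy), Pi.one_apply, if_pos hy]
    · rw [Set.indicator_of_notMem (fun h => hy (Finset.mem_coe.1 h)), if_neg hy]
  have hTbal' : IsBalanced (ℂ ≃+* ℂ) (familyType Φ)
      ((↑T : Set ((i : Fin n) × (K i →+* ℂ))).indicator (1 : ((i : Fin n) × (K i →+* ℂ)) → ℚ)) := by
    rw [hind]; exact (isGaloisBalancedAlg_iff_isBalanced_indicator Φ T).1 hTbal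
  have hSbal : IsBalanced (ℂ ≃+* ℂ) (familyType Φ) (fun y => if y ∈ S then (1 : ℚ) else 0) :=
    (isGaloisBalancedAlg_iff_isBalanced_indicator Φ S).1 hS.2
  obtain ⟨c, hc⟩ := exists_sub_rho_smul_eq_const_of_isBalanced h hrank' hΨ hTbal' hSbal
  have hc' : ∀ x ∈ T, (if x ∈ S then (1 : ℚ) else 0) - (if ρ • x ∈ S then (1 : ℚ) else 0) = c :=
    fun x hx => hc x (Finset.mem_coe.2 hx)
  by_cases hstab : ∀ x ∈ S, ρ • x ∈ S
  · exact Or.inl (mem_pohlmannDivisorSetsAlg_of_conj_smul_mem Φ q hS.1 hstab)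
  push Not at hstab
  obtain ⟨x₀, hx₀S, hx₀'⟩ := hstab
  right
  by_cases hx₀T : x₀ ∈ T
  · -- `c = 1`, `S = T`
    have hc1 : c = 1 := by have := hc' x₀ hx₀T; rw [if_pos hx₀S, if_neg hx₀'] at this; linarith
    left
    ext x
    constructor
    · intro hxS
      by_contra hxT
      have hρx : ρ • x ∈ T := by by_contra h'; exact hxT ((hT x).2 h')
      have h1 := hc' _ hρx
      rw [conj_smul_conj_smul, if_pos hxS, hc1] at h1
      split_ifs at h1 <;> norm_num at h1
    · intro hxT
      have h1 := hc' x hxT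
      rw [hc1] at h1
      by_contra hxS
      rw [if_neg hxS] at h1
      split_ifs at h1 <;> norm_num at h1
  · -- `c = -1`, `S = ρ • T`
    have hρx₀ : ρ • x₀ ∈ T := by by_contra h'; exact hx₀T ((hT x₀).2 h')
    have hc1 : c = -1 := by
      have := hc' _ hρx₀; rw [conj_smul_conj_smul, if_neg hx₀', if_pos hx₀S] at this; linarith
    right
    ext x
    rw [mem_conj_smul_finset_iff]
    constructor
    · intro hxS
      by_contra hxT
      have hxT' : x ∈ T := by by_contra h'; exact hxT (by have := (hT x); tauto)
      have h1 := hc' x hxT'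
      rw [if_pos hxS, hc1] at h1
      split_ifs at h1 <;> norm_num at h1
    · intro hρxT
      have h1 := hc' _ hρxT
      rw [conj_smul_conj_smul, hc1] at h1
      by_contra hxS
      rw [if_neg hxS] at h1
      split_ifs at h1 <;> norm_num at h1

/-- **`B^q = D^q` on the index sets off the degree of `T`**: for `2q ≠ |T|` every balanced `2q`-set is a divisor set.
[cite: vanGeemen1994HodgeAV, Thm. 6.12] [cite: Gordon1999HodgeAVSurvey, 9.2.2] -/
theorem pohlmannSetsAlg_subset_pohlmannDivisorSetsAlg_of_card_ne (hrank : (∑ i, finrank ℚ (K i)) / 2 ≤ cmFamilyRank Φ)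
    {T : Finset ((i : Fin n) × (K i →+* ℂ))} (hT : ∀ x, x ∈ T ↔ (starRingAut : ℂ ≃+* ℂ) • x ∉ T)
    (hTbal : IsGaloisBalancedAlg Φ T) {q : ℕ} (hq : 2 * q ≠ T.card) :
    pohlmannSetsAlg Φ q ⊆ pohlmannDivisorSetsAlg Φ q := fun S hS => by
  rcases mem_pohlmannDivisorSetsAlg_or_eq_or_eq_conj_smul hrank hT hTbal hS with h | rfl | rfl
  · exact h
  · exact absurd hS.1.symm hq
  · rw [mem_pohlmannSetsAlg_iff, card_smul_eq] at hS
    exact absurd hS.1.symm hq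

omit [∀ i, IsCMField (K i)] in
/-- **A transversal has `|T| = (Σ_i [K_i:ℚ])/2 = dim ⨁ A_i` elements**: `T ⊔ T̄ = ⊔_i Hom(K_i, ℂ)` («`S = Σ ⊔ ιΣ`» for any CM type `Σ` of
the CM algebra). [cite: Deligne1982HodgeCycles, I Ex. 3.7 (p. 25)] [cite: Shimura1998, §18.1] -/
theorem two_mul_card_eq_sum_finrank {T : Finset ((i : Fin n) × (K i →+* ℂ))}
    (hT : ∀ x, x ∈ T ↔ (starRingAut : ℂ ≃+* ℂ) • x ∉ T) : 2 * T.card = ∑ i, finrank ℚ (K i) := by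
  rw [← card_sigma_eq_sum_finrank]
  have hdisj : Disjoint T ((starRingAut : ℂ ≃+* ℂ) • T) :=
    Finset.disjoint_left.2 fun x hx hx' => (hT x).1 hx ((mem_conj_smul_finset_iff T x).1 hx')
  have hunion : T ∪ (starRingAut : ℂ ≃+* ℂ) • T = Finset.univ := by
    ext x
    simp only [Finset.mem_union, Finset.mem_univ, iff_true]
    by_cases hx : x ∈ T
    · exact Or.inl hx
    · exact Or.inr ((mem_conj_smul_finset_iff T x).2 (by by_contra h'; exact hx ((hT x).2 h')))
  have h1 := Finset.card_union_of_disjoint hdisj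
  rw [hunion, card_smul_eq, Finset.card_univ] at h1
  omega

/-- Off the middle degree, `4q ≠ Σ_i [K_i:ℚ]`: `pohlmannSetsAlg Φ q ⊆ pohlmannDivisorSetsAlg Φ q`. [cite: vanGeemen1994HodgeAV, Thm. 6.12] -/
theorem pohlmannSetsAlg_subset_pohlmannDivisorSetsAlg_of_ne (hrank : (∑ i, finrank ℚ (K i)) / 2 ≤ cmFamilyRank Φ)
    {T : Finset ((i : Fin n) × (K i →+* ℂ))} (hT : ∀ x, x ∈ T ↔ (starRingAut : ℂ ≃+* ℂ) • x ∉ T)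
    (hTbal : IsGaloisBalancedAlg Φ T) {q : ℕ} (hq : 4 * q ≠ ∑ i, finrank ℚ (K i)) :
    pohlmannSetsAlg Φ q ⊆ pohlmannDivisorSetsAlg Φ q :=
  pohlmannSetsAlg_subset_pohlmannDivisorSetsAlg_of_card_ne hrank hT hTbal fun h => hq (by
    have := two_mul_card_eq_sum_finrank hT; omega)

/-- **A non-divisorial balanced transversal of a corank-`≤ 1` family is a WEIL SECTION**: `τ • T ∈ {T, T̄}` for every `τ ∈ Aut(ℂ)`
(`τ • T` is balanced, and not a divisor set since `T = τ⁻¹ • τ • T` is not). [cite: MoonenZarhin1999LowDim, §1 (1.9)]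
[cite: Gordon1999HodgeAVSurvey, 5.13 and 9.5] -/
theorem smul_eq_or_eq_conj_smul_of_not_mem (hrank : (∑ i, finrank ℚ (K i)) / 2 ≤ cmFamilyRank Φ)
    {T : Finset ((i : Fin n) × (K i →+* ℂ))} (hT : ∀ x, x ∈ T ↔ (starRingAut : ℂ ≃+* ℂ) • x ∉ T)
    {m : ℕ} (hTm : T ∈ pohlmannSetsAlg Φ m) (hTD : T ∉ pohlmannDivisorSetsAlg Φ m) (τ : ℂ ≃+* ℂ) :
    τ • T = T ∨ τ • T = (starRingAut : ℂ ≃+* ℂ) • T := by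
  rcases mem_pohlmannDivisorSetsAlg_or_eq_or_eq_conj_smul hrank hT hTm.2 (smul_mem_pohlmannSetsAlg hTm τ) with h | h | h
  · exact absurd (by have := smul_mem_pohlmannDivisorSetsAlg (Φ := Φ) τ⁻¹ h; rwa [inv_smul_smul_finset] at this) hTD
  · exact Or.inl h
  · exact Or.inr h

omit [∀ i, NumberField (K i)] [∀ i, IsCMField (K i)] in
/-- **The conjugate transversal `T̄` is not a divisor set either** (`T = ρ • ρ • T`). [cite: Gordon1999HodgeAVSurvey, 9.2.2] -/
theorem conj_smul_not_mem_pohlmannDivisorSetsAlg {T : Finset ((i : Fin n) × (K i →+* ℂ))} {m : ℕ}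
    (hTD : T ∉ pohlmannDivisorSetsAlg Φ m) : (starRingAut : ℂ ≃+* ℂ) • T ∉ pohlmannDivisorSetsAlg Φ m := fun h =>
  hTD (by have := smul_mem_pohlmannDivisorSetsAlg (Φ := Φ) (starRingAut : ℂ ≃+* ℂ) h; rwa [conj_smul_conj_smul_finset] at this)

/-- **The exceptional balanced sets are EXACTLY `T` and `T̄`** (in the degree `m` of `T`; none in other degrees).
[cite: MoonenZarhin1999LowDim, Thm. 0.1 (1)] [cite: vanGeemen1994HodgeAV, Thm. 6.12] -/
theorem mem_pohlmannSetsAlg_diff_iff (hrank : (∑ i, finrank ℚ (K i)) / 2 ≤ cmFamilyRank Φ)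
    {T : Finset ((i : Fin n) × (K i →+* ℂ))} (hT : ∀ x, x ∈ T ↔ (starRingAut : ℂ ≃+* ℂ) • x ∉ T)
    {m : ℕ} (hTm : T ∈ pohlmannSetsAlg Φ m) (hTD : T ∉ pohlmannDivisorSetsAlg Φ m) (S : Finset ((i : Fin n) × (K i →+* ℂ))) :
    S ∈ pohlmannSetsAlg Φ m \ pohlmannDivisorSetsAlg Φ m ↔ S = T ∨ S = (starRingAut : ℂ ≃+* ℂ) • T := by
  constructor
  · intro hS
    rcases mem_pohlmannDivisorSetsAlg_or_eq_or_eq_conj_smul hrank hT hTm.2 hS.1 with h | h | h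
    · exact absurd h hS.2
    · exact Or.inl h
    · exact Or.inr h
  · rintro (rfl | rfl)
    · exact ⟨hTm, hTD⟩
    · exact ⟨smul_mem_pohlmannSetsAlg hTm _, conj_smul_not_mem_pohlmannDivisorSetsAlg hTD⟩

omit [∀ i, NumberField (K i)] [∀ i, IsCMField (K i)] in
/-- `T ≠ T̄` for a transversal. [folklore] -/
private theorem ne_conj_smul_of_transversal {T : Finset ((i : Fin n) × (K i →+* ℂ))}
    (hT : ∀ x, x ∈ T ↔ (starRingAut : ℂ ≃+* ℂ) • x ∉ T) (hT0 : T.Nonempty) : T ≠ (starRingAut : ℂ ≃+* ℂ) • T := by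
  intro h
  obtain ⟨x, hx⟩ := hT0
  have hx' : x ∈ (starRingAut : ℂ ≃+* ℂ) • T := h ▸ hx
  exact (hT x).1 hx ((mem_conj_smul_finset_iff T x).1 hx')

/-- **Exactly TWO exceptional sets**: `#(pohlmannSetsAlg Φ m ∖ pohlmannDivisorSetsAlg Φ m) = 2`, so `dim B^m(⨁ A_i) = dim D^m(⨁ A_i) + 2`
(Gordon 5.13 (ii) «`dim Hdg² = 8`, `dim Div² = 6`» in the octic simple case). [cite: Gordon1999HodgeAVSurvey, 5.13 (ii)]
[cite: MoonenZarhin1999LowDim, Thm. 0.1 (1)] -/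
theorem ncard_pohlmannSetsAlg_diff_eq_two (hrank : (∑ i, finrank ℚ (K i)) / 2 ≤ cmFamilyRank Φ)
    {T : Finset ((i : Fin n) × (K i →+* ℂ))} (hT : ∀ x, x ∈ T ↔ (starRingAut : ℂ ≃+* ℂ) • x ∉ T)
    {m : ℕ} (hm : 0 < m) (hTm : T ∈ pohlmannSetsAlg Φ m) (hTD : T ∉ pohlmannDivisorSetsAlg Φ m) :
    (pohlmannSetsAlg Φ m \ pohlmannDivisorSetsAlg Φ m).ncard = 2 := by
  have hT0 : T.Nonempty := by rw [← Finset.card_pos, hTm.1]; omega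
  have hset : pohlmannSetsAlg Φ m \ pohlmannDivisorSetsAlg Φ m = {T, (starRingAut : ℂ ≃+* ℂ) • T} := by
    ext S
    rw [mem_pohlmannSetsAlg_diff_iff hrank hT hTm hTD S]
    simp
  rw [hset, Set.ncard_pair (ne_conj_smul_of_transversal hT hT0)]

end Classification

/-! ## §3 The Weil fibre of a diagonal square root `a ∈ ∏_i 𝓞_{K_i}`, `a_i² = −d` -/

section WeilFibre

variable {n : ℕ} {K : Fin n → Type} [∀ i, Field (K i)]

/-- `(i√d)² = −d`. [folklore] -/
private theorem I_mul_sqrt_sq (d : ℕ) : (Complex.I * (Real.sqrt d : ℂ)) ^ 2 = -(d : ℂ) := by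
  rw [mul_pow, Complex.I_sq, ← Complex.ofReal_pow, Real.sq_sqrt (Nat.cast_nonneg d)]
  push_cast
  ring

/-- `i√d ≠ 0` for `d ≥ 1`. [folklore] -/
private theorem I_mul_sqrt_ne_zero' {d : ℕ} (hd : 0 < d) : Complex.I * (Real.sqrt d : ℂ) ≠ 0 := by
  refine mul_ne_zero Complex.I_ne_zero ?_
  rw [Ne, Complex.ofReal_eq_zero, Real.sqrt_eq_zero (Nat.cast_nonneg d)]
  exact_mod_cast hd.ne'

/-- **Every complex embedding sends a square root `a_i` of `−d` to `± i√d`** (the two eigenvalues of `φ^*` on `H¹`, van Geemen 4.9 / 5.2).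
[cite: vanGeemen1994HodgeAV, 4.9 and Lemma 5.2] -/
theorem apply_eq_or_eq_neg (a : ∀ i, 𝓞 (K i)) {d : ℕ} (ha : ∀ i, a i * a i = -(d : 𝓞 (K i)))
    (x : (i : Fin n) × (K i →+* ℂ)) :
    x.2 ((a x.1 : 𝓞 (K x.1)) : K x.1) = Complex.I * (Real.sqrt d : ℂ) ∨
      x.2 ((a x.1 : 𝓞 (K x.1)) : K x.1) = -(Complex.I * (Real.sqrt d : ℂ)) := by
  apply sq_eq_sq_iff_eq_or_eq_neg.1
  rw [I_mul_sqrt_sq, sq, ← map_mul]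
  have h := congrArg (fun z : 𝓞 (K x.1) => x.2 (z : K x.1)) (ha x.1)
  simpa using h

variable [∀ i, NumberField (K i)]

omit [∀ i, NumberField (K i)] in
/-- Conjugation negates the eigenvalue: `s̄(a_i) = conj(s(a_i))`. [folklore] -/
private theorem conj_smul_apply_eq (a : ∀ i, 𝓞 (K i)) (x : (i : Fin n) × (K i →+* ℂ)) :
    ((starRingAut : ℂ ≃+* ℂ) • x).2 ((a ((starRingAut : ℂ ≃+* ℂ) • x).1 : 𝓞 (K _)) : K _) =
      starRingEnd ℂ (x.2 ((a x.1 : 𝓞 (K x.1)) : K x.1)) := by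
  rw [conj_smul_sigma_eq]
  exact ComplexEmbedding.conjugate_coe_eq x.2 _

/-- **The Weil fibre `T_a = {(i, s) : s(a_i) = i√d}` is a TRANSVERSAL**: `x ∈ T_a ↔ x̄ ∉ T_a` (`d ≥ 1`).
[cite: vanGeemen1994HodgeAV, 4.9] [cite: MoonenZarhin1999LowDim, §1 (1.9)] -/
theorem mem_weilFibre_iff_conj_smul_not_mem (a : ∀ i, 𝓞 (K i)) {d : ℕ} (hd : 0 < d) (ha : ∀ i, a i * a i = -(d : 𝓞 (K i)))
    (x : (i : Fin n) × (K i →+* ℂ)) :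
    x ∈ Finset.univ.filter (fun y : (i : Fin n) × (K i →+* ℂ) => y.2 ((a y.1 : 𝓞 (K y.1)) : K y.1) = Complex.I * (Real.sqrt d : ℂ)) ↔
      (starRingAut : ℂ ≃+* ℂ) • x ∉ Finset.univ.filter
        (fun y : (i : Fin n) × (K i →+* ℂ) => y.2 ((a y.1 : 𝓞 (K y.1)) : K y.1) = Complex.I * (Real.sqrt d : ℂ)) := by
  simp only [Finset.mem_filter, Finset.mem_univ, true_and]
  rw [conj_smul_apply_eq]
  have hne := I_mul_sqrt_ne_zero' hd
  have hconj : starRingEnd ℂ (Complex.I * (Real.sqrt d : ℂ)) = -(Complex.I * (Real.sqrt d : ℂ)) := by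
    rw [map_mul, Complex.conj_I, Complex.conj_ofReal, neg_mul]
  rcases apply_eq_or_eq_neg a ha x with h | h
  · refine ⟨fun _ hc => ?_, fun _ => h⟩
    rw [h, hconj] at hc
    exact hne (by linear_combination (-(1 : ℂ) / 2) * hc)
  · refine ⟨fun h1 => ?_, fun hc => ?_⟩
    · exfalso
      rw [h] at h1
      exact hne (by linear_combination (-(1 : ℂ) / 2) * h1)
    · exfalso
      apply hc
      rw [h, map_neg, hconj, neg_neg]

/-- **The complement of the Weil fibre is the fibre of `−i√d`**: `x ∉ T_a ↔ x(a) = −i√d`. [cite: vanGeemen1994HodgeAV, 4.9] -/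
theorem not_mem_weilFibre_iff (a : ∀ i, 𝓞 (K i)) {d : ℕ} (hd : 0 < d) (ha : ∀ i, a i * a i = -(d : 𝓞 (K i)))
    (x : (i : Fin n) × (K i →+* ℂ)) :
    x ∉ Finset.univ.filter (fun y : (i : Fin n) × (K i →+* ℂ) => y.2 ((a y.1 : 𝓞 (K y.1)) : K y.1) = Complex.I * (Real.sqrt d : ℂ)) ↔
      x.2 ((a x.1 : 𝓞 (K x.1)) : K x.1) = -(Complex.I * (Real.sqrt d : ℂ)) := by
  simp only [Finset.mem_filter, Finset.mem_univ, true_and]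
  have hne := I_mul_sqrt_ne_zero' hd
  rcases apply_eq_or_eq_neg a ha x with h | h
  · rw [h]
    simp only [not_true_eq_false, false_iff]
    intro h'
    exact hne (by linear_combination (1 : ℂ) / 2 * h')
  · rw [h]
    simp only [iff_true]
    intro h'
    exact hne (by linear_combination (-(1 : ℂ) / 2) * h')

/-- **The conjugate fibre**: `ρ • T_a = {x : x(a) = −i√d}`, i.e. `x ∈ ρ • T_a ↔ x ∉ T_a`. [cite: vanGeemen1994HodgeAV, 4.9] -/
theorem mem_conj_smul_weilFibre_iff (a : ∀ i, 𝓞 (K i)) {d : ℕ} (hd : 0 < d) (ha : ∀ i, a i * a i = -(d : 𝓞 (K i)))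
    (x : (i : Fin n) × (K i →+* ℂ)) :
    x ∈ (starRingAut : ℂ ≃+* ℂ) • Finset.univ.filter
        (fun y : (i : Fin n) × (K i →+* ℂ) => y.2 ((a y.1 : 𝓞 (K y.1)) : K y.1) = Complex.I * (Real.sqrt d : ℂ)) ↔
      x.2 ((a x.1 : 𝓞 (K x.1)) : K x.1) = -(Complex.I * (Real.sqrt d : ℂ)) := by
  rw [mem_conj_smul_finset_iff, mem_weilFibre_iff_conj_smul_not_mem a hd ha ((starRingAut : ℂ ≃+* ℂ) • x), conj_smul_conj_smul,
    not_mem_weilFibre_iff a hd ha x]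

/-- **`Aut(ℂ)` moves the Weil fibre to itself or to its conjugate** (`τ(i√d) = ± i√d`). [cite: MoonenZarhin1999LowDim, §1 (1.9)]
[cite: Deligne1982HodgeCycles, §4 Prop. 4.4] -/
theorem smul_weilFibre_eq_or (a : ∀ i, 𝓞 (K i)) {d : ℕ} (hd : 0 < d) (ha : ∀ i, a i * a i = -(d : 𝓞 (K i))) (τ : ℂ ≃+* ℂ) :
    τ • Finset.univ.filter (fun y : (i : Fin n) × (K i →+* ℂ) => y.2 ((a y.1 : 𝓞 (K y.1)) : K y.1) = Complex.I * (Real.sqrt d : ℂ)) =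
        Finset.univ.filter (fun y : (i : Fin n) × (K i →+* ℂ) => y.2 ((a y.1 : 𝓞 (K y.1)) : K y.1) = Complex.I * (Real.sqrt d : ℂ)) ∨
      τ • Finset.univ.filter (fun y : (i : Fin n) × (K i →+* ℂ) => y.2 ((a y.1 : 𝓞 (K y.1)) : K y.1) = Complex.I * (Real.sqrt d : ℂ)) =
        (starRingAut : ℂ ≃+* ℂ) • Finset.univ.filter
          (fun y : (i : Fin n) × (K i →+* ℂ) => y.2 ((a y.1 : 𝓞 (K y.1)) : K y.1) = Complex.I * (Real.sqrt d : ℂ)) := by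
  set μ : ℂ := Complex.I * (Real.sqrt d : ℂ) with hμ
  -- `τ μ = ± μ`
  have hτμ : τ μ = μ ∨ τ μ = -μ := by
    apply sq_eq_sq_iff_eq_or_eq_neg.1
    rw [← map_pow, hμ, I_mul_sqrt_sq, map_neg, map_natCast]
  -- membership in `τ • T_a`: `x ∈ τ • T_a ↔ τ⁻¹ (x(a)) = μ ↔ x(a) = τ μ`
  have key : ∀ x : (i : Fin n) × (K i →+* ℂ),
      x ∈ τ • Finset.univ.filter (fun y : (i : Fin n) × (K i →+* ℂ) => y.2 ((a y.1 : 𝓞 (K y.1)) : K y.1) = μ) ↔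
        x.2 ((a x.1 : 𝓞 (K x.1)) : K x.1) = τ μ := by
    intro x
    rw [Finset.mem_smul_finset]
    constructor
    · rintro ⟨y, hy, rfl⟩
      rw [Finset.mem_filter] at hy
      rw [smul_sigma_eq]
      change τ (y.2 _) = τ μ
      rw [hy.2]
    · intro hx
      refine ⟨τ⁻¹ • x, ?_, smul_inv_smul τ x⟩
      rw [Finset.mem_filter, smul_sigma_eq]
      refine ⟨Finset.mem_univ _, ?_⟩
      change τ⁻¹ (x.2 _) = μ
      rw [hx]
      exact τ.symm_apply_apply μ
  rcases hτμ with h | h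
  · left
    ext x
    rw [key x, h, Finset.mem_filter]
    simp
  · right
    ext x
    rw [key x, h, mem_conj_smul_weilFibre_iff a hd ha x]

/-- **A Weil section is balanced as soon as ONE count balances.**  If `τ • T ∈ {T, T̄}` for every `τ ∈ Aut(ℂ)` and `T` is a transversal,
then Pohlmann's condition for `T` reduces to `#{x ∈ T : x ∈ Σ} = #{x ∈ T : x ∉ Σ}` — «`k` acts with multiplicities `(m, m)`»
(Deligne–Milne 4.4: the Weil classes of `k` are Hodge classes exactly in the balanced case). [cite: Deligne1982HodgeCycles, §4 Prop. 4.4]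
[cite: vanGeemen1994HodgeAV, 4.9 and Lemma 5.2] [cite: Gordon1999HodgeAVSurvey, §9.2 (9.2.1)] -/
theorem isGaloisBalancedAlg_of_smul_eq_or [∀ i, IsCMField (K i)] (Φ : ∀ i, CMType (K i)) {T : Finset ((i : Fin n) × (K i →+* ℂ))}
    (hW : ∀ τ : ℂ ≃+* ℂ, τ • T = T ∨ τ • T = (starRingAut : ℂ ≃+* ℂ) • T)
    (hcount : {x | x ∈ T ∧ x.2 ∈ (Φ x.1).1}.ncard = {x | x ∈ T ∧ x.2 ∉ (Φ x.1).1}.ncard) : IsGaloisBalancedAlg Φ T := by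
  -- counting through `τ`: `#{x ∈ T : τ x ∈ Σ} = #{y ∈ τ • T : y ∈ Σ}`
  have count : ∀ (τ : ℂ ≃+* ℂ) (Q : ∀ i, (K i →+* ℂ) → Prop),
      {x | x ∈ T ∧ Q x.1 ((τ : ℂ →+* ℂ).comp x.2)}.ncard = {x | x ∈ τ • T ∧ Q x.1 x.2}.ncard := by
    intro τ Q
    rw [show {x | x ∈ τ • T ∧ Q x.1 x.2} = (fun y => τ • y) '' {x | x ∈ T ∧ Q x.1 ((τ : ℂ →+* ℂ).comp x.2)} by
      ext x
      simp only [Set.mem_setOf_eq, Finset.mem_smul_finset, Set.mem_image]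
      constructor
      · rintro ⟨⟨y, hy, rfl⟩, hQ⟩; exact ⟨y, ⟨hy, hQ⟩, rfl⟩
      · rintro ⟨y, ⟨hy, hQ⟩, rfl⟩; exact ⟨⟨y, hy, rfl⟩, hQ⟩,
      Set.ncard_image_of_injective _ (MulAction.injective τ)]
  have h1 := ncard_sep_conj_smul_mem Φ (1 : ℂ ≃+* ℂ) T
  have h2 := ncard_sep_conj_smul_not_mem Φ (1 : ℂ ≃+* ℂ) T
  have hone : ∀ x : (i : Fin n) × (K i →+* ℂ), ((1 : ℂ ≃+* ℂ) : ℂ →+* ℂ).comp x.2 = x.2 := fun x => RingHom.ext fun _ => rfl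
  simp only [hone] at h1 h2
  intro τ
  rw [count τ (fun i s => s ∈ (Φ i).1), count τ (fun i s => s ∉ (Φ i).1)]
  rcases hW τ with h | h
  · rw [h]; exact hcount
  · rw [h, h1, h2]; exact hcount.symm

end WeilFibre

/-! ## §4 Geometry: `B• = D• ⊕ W_k` on `⨁_i A_i`, Weil type, and the Hodge conjecture from the one Weil plane -/

section Geometry

variable {n : ℕ} {K : Fin n → Type} [∀ i, Field (K i)] [∀ i, NumberField (K i)] [∀ i, IsCMField (K i)]
  {Φ : ∀ i, CMType (K i)} {A : Fin n → AbelianVariety ℂ} {ι : ∀ i, 𝓞 (K i) →+* End (A i)}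
  {θ : ∀ i, K i →+* Module.End ℂ (complexBetti (A i).X 1)}

omit [∀ i, IsCMField (K i)] in
/-- `dim ⨁ A_i = (Σ_i [K_i:ℚ])/2`. [cite: vanGeemen1994HodgeAV, 4.9 and Lemma 5.2] -/
theorem dim_biproduct_eq (hA : ∀ i, IsCMTypeRealisation (Φ i) (A i) (ι i) (θ i)) :
    (⨁ A).dim = (∑ i, finrank ℚ (K i)) / 2 := by
  have h := sum_finrank_eq_two_mul_dim hA
  omega

/-- **`B^q(⨁ A_i) ⊗ ℂ = D^q(⨁ A_i) ⊗ ℂ` OFF THE MIDDLE DEGREE** (`4q ≠ Σ_i [K_i:ℚ] = 2 dim`) for a corank-`≤ 1` family with a balanced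
transversal — van Geemen 6.12 «`Bᵖ(X) = Dᵖ` for `p ≠ n`» for these CM products. [cite: vanGeemen1994HodgeAV, Thm. 6.12]
[cite: GaoUllmo2025, Thm. 3.1] [cite: Gordon1999HodgeAVSurvey, 9.2.2] -/
theorem hodgeClassSpan_eq_divisorClassesSpan_of_ne (hrank : (∑ i, finrank ℚ (K i)) / 2 ≤ cmFamilyRank Φ)
    {T : Finset ((i : Fin n) × (K i →+* ℂ))} (hT : ∀ x, x ∈ T ↔ (starRingAut : ℂ ≃+* ℂ) • x ∉ T)
    (hTbal : IsGaloisBalancedAlg Φ T) (hA : ∀ i, IsCMTypeRealisation (Φ i) (A i) (ι i) (θ i)) {q : ℕ}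
    (hq : 4 * q ≠ ∑ i, finrank ℚ (K i)) :
    hodgeClassSpan (⨁ A).dim (⨁ A).X q = divisorClassesSpan (⨁ A).X (⨁ A).dim q := by
  refine le_antisymm ?_ (divisorClassesSpan_biproduct_le_hodgeClassSpan hA q)
  rw [divisorClassesSpan_biproduct_eq_iSup hA q, (Pohlmann1968_thm1_cmAlgebra K A Φ ι θ hA q).1]
  exact iSup₂_le fun S hS =>
    le_iSup₂_of_le S (pohlmannSetsAlg_subset_pohlmannDivisorSetsAlg_of_ne hrank hT hTbal hq hS) le_rfl

omit [∀ i, IsCMField (K i)] in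
/-- **The Weil line of the fibre**: `H^{2m}(⨁A)_{T_a} ⊆ E₊(⨁A, φ_a)` and `H^{2m}(⨁A)_{T̄_a} ⊆ E₋(⨁A, φ_a)`, hence both lie in the Weil plane
`W_k ⊗ ℂ = weilClassesOf (⨁ A) φ_a m d`. [cite: vanGeemen1994HodgeAV, 4.9 and proof of Thm. 6.12] -/
theorem weightClassesAlg_weilFibre_le (a : ∀ i, 𝓞 (K i)) {d : ℕ} (hd : 0 < d) (ha : ∀ i, a i * a i = -(d : 𝓞 (K i))) {m : ℕ}
    (hcard : (Finset.univ.filter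
      (fun y : (i : Fin n) × (K i →+* ℂ) => y.2 ((a y.1 : 𝓞 (K y.1)) : K y.1) = Complex.I * (Real.sqrt d : ℂ))).card = 2 * m) :
    weightClassesAlg A ι (2 * m) (Finset.univ.filter
        (fun y : (i : Fin n) × (K i →+* ℂ) => y.2 ((a y.1 : 𝓞 (K y.1)) : K y.1) = Complex.I * (Real.sqrt d : ℂ))) ≤
      weilClassesOf (⨁ A) (biproduct.map fun i => ι i (a i)) m d ∧
    weightClassesAlg A ι (2 * m) ((starRingAut : ℂ ≃+* ℂ) • Finset.univ.filter
        (fun y : (i : Fin n) × (K i →+* ℂ) => y.2 ((a y.1 : 𝓞 (K y.1)) : K y.1) = Complex.I * (Real.sqrt d : ℂ))) ≤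
      weilClassesOf (⨁ A) (biproduct.map fun i => ι i (a i)) m d := by
  constructor
  · refine (weightClassesAlg_le_weilClassesPlus (A := A) (ι := ι) a hcard fun z hz => ?_).trans
      (weilClassesPlus_le_weilClassesOf _ _ m d)
    exact (Finset.mem_filter.1 hz).2
  · refine (weightClassesAlg_le_weilClassesMinus (A := A) (ι := ι) a (by rw [card_smul_eq, hcard]) fun z hz => ?_).trans
      (weilClassesMinus_le_weilClassesOf _ _ m d)
    exact (mem_conj_smul_weilFibre_iff a hd ha z).1 hz

omit [∀ i, IsCMField (K i)] in
/-- **`(⨁ A_i, φ_a)` IS OF WEIL TYPE `(m, d)`** when the Weil fibre `T_a` (`|T_a| = 2m = dim ⨁A`, `m ≥ 1`) satisfies Pohlmann's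
condition: its weight line is a NON-ZERO line of `(m,m)`-classes inside the Weil plane (Pohlmann's theorem + Deligne–Milne 4.4 (⇒),
the tree's `isWeilType_of_weilClass_ne_zero`). [cite: Deligne1982HodgeCycles, §4 Prop. 4.4] [cite: vanGeemen1994HodgeAV, 4.9–4.10]
[cite: GaoUllmo2025, Thm. 3.1] -/
theorem isWeilType (hA : ∀ i, IsCMTypeRealisation (Φ i) (A i) (ι i) (θ i)) (a : ∀ i, 𝓞 (K i)) {d : ℕ} (hd : 0 < d)
    (ha : ∀ i, a i * a i = -(d : 𝓞 (K i))) {m : ℕ} (hm : 0 < m) (hm4 : 4 * m = ∑ i, finrank ℚ (K i))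
    (hTbal : IsGaloisBalancedAlg Φ (Finset.univ.filter
      (fun y : (i : Fin n) × (K i →+* ℂ) => y.2 ((a y.1 : 𝓞 (K y.1)) : K y.1) = Complex.I * (Real.sqrt d : ℂ)))) :
    IsWeilType (⨁ A) (biproduct.map fun i => ι i (a i)) m d := by
  set T := Finset.univ.filter
      (fun y : (i : Fin n) × (K i →+* ℂ) => y.2 ((a y.1 : 𝓞 (K y.1)) : K y.1) = Complex.I * (Real.sqrt d : ℂ)) with hTdef
  have hT := mem_weilFibre_iff_conj_smul_not_mem a hd ha
  have hcard : T.card = 2 * m := by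
    have h2 : 2 * T.card = ∑ i, finrank ℚ (K i) := two_mul_card_eq_sum_finrank hT
    omega
  have hTm : T ∈ pohlmannSetsAlg Φ m := ⟨hcard, hTbal⟩
  have hdim : (⨁ A).dim = 2 * m := by rw [dim_biproduct_eq hA]; omega
  have hφ := biproduct_map_comp_self_eq_neg (A := A) (ι := ι) a ha
  obtain ⟨hle, -⟩ := weightClassesAlg_weilFibre_le (A := A) (ι := ι) a hd ha hcard
  -- a non-zero vector on the line `H^{2m}(⨁A)_T`
  letI : LinearOrder ((i : Fin n) × (K i →+* ℂ)) :=
    LinearOrder.lift' (Fintype.equivFin _) (Fintype.equivFin _).injective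
  obtain ⟨w, hw, -, -⟩ := exists_eigenbasis_biproduct hA
  obtain ⟨b, hb⟩ := exists_monomialBasis w (2 * m)
  let u : Set.powersetCard ((i : Fin n) × (K i →+* ℂ)) (2 * m) := Set.powersetCard.ofCard hcard
  have hline : weightClassesAlg A ι (2 * m) T = ℂ ∙ b u := weightClassesAlg_eq_span_singleton hw hb u
  have hbu : b u ∈ weightClassesAlg A ι (2 * m) T := by rw [hline]; exact Submodule.mem_span_singleton_self _
  have hpp : IsOfHodgeType (2 * m) (⨁ A).X (2 * m) m m (b u) := by
    have h := isOfHodgeType_of_mem_hodgeClassSpan_smoothProjective (Motives.AbelianVariety.isSmoothProjective_holds (A := ⨁ A))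
      (weightClassesAlg_le_hodgeClassSpan hA hTm hbu)
    rwa [hdim] at h
  exact isWeilType_of_weilClass_ne_zero hm hd hdim hφ (hle hbu) (b.ne_zero u) hpp

/-- **`B^m(⨁ A_i) ⊗ ℂ = D^m(⨁ A_i) ⊗ ℂ ⊔ W_k ⊗ ℂ` IN THE MIDDLE DEGREE** `4m = Σ_i [K_i:ℚ]`, for a corank-`≤ 1` family whose Weil fibre
`T_a` is balanced: Moonen–Zarhin's «`B•(X)` is generated by `D•(X)` together with the space of Weil classes `W_k`» (Thm. 0.1 (1), case (a),
there for fourfolds `E × T`) and van Geemen's 6.12 «`Bⁿ = Dⁿ ⊕ ⋀_K^{2n} H¹`», here for every such CM product, any dimension: by Pohlmann's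
theorem the lines of `B^m ⊗ ℂ` are indexed by the balanced `2m`-sets, which are divisor sets (`⊆ D^m ⊗ ℂ`) or `T_a ⊆ E₊`, `T̄_a ⊆ E₋`
(§2–§3); conversely `W_k ⊗ ℂ` is spanned by rational `(m,m)`-classes (Weil type). [cite: MoonenZarhin1999LowDim, Thm. 0.1 (1)]
[cite: vanGeemen1994HodgeAV, Thm. 6.12 and 4.9] [cite: GaoUllmo2025, Thm. 3.1] [cite: Milne2020HodgeClassesAV, Thm. 1] -/
theorem hodgeClassSpan_eq_divisorClassesSpan_sup_weilClassesOf (hrank : (∑ i, finrank ℚ (K i)) / 2 ≤ cmFamilyRank Φ)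
    (hA : ∀ i, IsCMTypeRealisation (Φ i) (A i) (ι i) (θ i)) (a : ∀ i, 𝓞 (K i)) {d : ℕ} (hd : 0 < d)
    (ha : ∀ i, a i * a i = -(d : 𝓞 (K i))) {m : ℕ} (hm : 0 < m) (hm4 : 4 * m = ∑ i, finrank ℚ (K i))
    (hTbal : IsGaloisBalancedAlg Φ (Finset.univ.filter
      (fun y : (i : Fin n) × (K i →+* ℂ) => y.2 ((a y.1 : 𝓞 (K y.1)) : K y.1) = Complex.I * (Real.sqrt d : ℂ)))) :
    hodgeClassSpan (⨁ A).dim (⨁ A).X m =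
      divisorClassesSpan (⨁ A).X (⨁ A).dim m ⊔ weilClassesOf (⨁ A) (biproduct.map fun i => ι i (a i)) m d := by
  set T := Finset.univ.filter
      (fun y : (i : Fin n) × (K i →+* ℂ) => y.2 ((a y.1 : 𝓞 (K y.1)) : K y.1) = Complex.I * (Real.sqrt d : ℂ)) with hTdef
  have hT := mem_weilFibre_iff_conj_smul_not_mem a hd ha
  have hcard : T.card = 2 * m := by
    have h2 : 2 * T.card = ∑ i, finrank ℚ (K i) := two_mul_card_eq_sum_finrank hT
    omega
  have hdim : (⨁ A).dim = 2 * m := by rw [dim_biproduct_eq hA]; omega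
  have hφ := biproduct_map_comp_self_eq_neg (A := A) (ι := ι) a ha
  have hWT := isWeilType hA a hd ha hm hm4 hTbal
  obtain ⟨hleP, hleM⟩ := weightClassesAlg_weilFibre_le (A := A) (ι := ι) a hd ha hcard
  apply le_antisymm
  · rw [(Pohlmann1968_thm1_cmAlgebra K A Φ ι θ hA m).1]
    refine iSup₂_le fun S hS => ?_
    rcases mem_pohlmannDivisorSetsAlg_or_eq_or_eq_conj_smul hrank hT hTbal hS with h | rfl | rfl
    · refine le_sup_of_le_left ?_
      rw [divisorClassesSpan_biproduct_eq_iSup hA m]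
      exact le_iSup₂_of_le S h le_rfl
    · exact le_sup_of_le_right hleP
    · exact le_sup_of_le_right hleM
  · refine sup_le (divisorClassesSpan_biproduct_le_hodgeClassSpan hA m) ?_
    rw [weilClassesOf_eq_span_isRationalClass hm hdim hd hφ]
    refine Submodule.span_mono ?_
    rintro c ⟨hcQ, hcW⟩
    refine ⟨hcQ, ?_⟩
    rw [hdim]
    exact hWT.isOfHodgeType_of_mem_weilClassesOf hcW

/-- **The Hodge classes of `⨁ A_i` are generated by divisors and the ONE Weil plane of `φ_a`** (the tree's `IsDivisorWeilGenerated`).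
[cite: vanGeemen1994HodgeAV, Thm. 6.12] [cite: MoonenZarhin1999LowDim, Thm. 0.1 (1)] [cite: Gordon1999HodgeAVSurvey, 9.5] -/
theorem isDivisorWeilGenerated (hrank : (∑ i, finrank ℚ (K i)) / 2 ≤ cmFamilyRank Φ)
    (hA : ∀ i, IsCMTypeRealisation (Φ i) (A i) (ι i) (θ i)) (a : ∀ i, 𝓞 (K i)) {d : ℕ} (hd : 0 < d)
    (ha : ∀ i, a i * a i = -(d : 𝓞 (K i))) {m : ℕ} (hm : 0 < m) (hm4 : 4 * m = ∑ i, finrank ℚ (K i))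
    (hTbal : IsGaloisBalancedAlg Φ (Finset.univ.filter
      (fun y : (i : Fin n) × (K i →+* ℂ) => y.2 ((a y.1 : 𝓞 (K y.1)) : K y.1) = Complex.I * (Real.sqrt d : ℂ)))) :
    IsDivisorWeilGenerated (⨁ A) (biproduct.map fun i => ι i (a i)) m d := by
  have hT := mem_weilFibre_iff_conj_smul_not_mem a hd ha
  have hdimK : (⨁ A).dim = (∑ i, finrank ℚ (K i)) / 2 := dim_biproduct_eq hA
  refine ⟨fun q c hq hcQ hcH => ?_, fun c hcQ hcH => ?_⟩
  · have hq' : 4 * q ≠ ∑ i, finrank ℚ (K i) := fun h => hq (by omega)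
    rw [← hodgeClassSpan_eq_divisorClassesSpan_of_ne hrank hT hTbal hA hq']
    exact Submodule.subset_span ⟨hcQ, hcH⟩
  · rw [← hodgeClassSpan_eq_divisorClassesSpan_sup_weilClassesOf hrank hA a hd ha hm hm4 hTbal]
    exact Submodule.subset_span ⟨hcQ, hcH⟩

omit [∀ i, IsCMField (K i)] in
/-- **`B^m(⨁ A_i) ≠ D^m(⨁ A_i)`: a rational `(m,m)`-class OUTSIDE `D^m ⊗ ℂ`** as soon as the balanced Weil fibre is not a divisor set
(Pohlmann's criterion `exists_exceptional_biproduct_iff`) — «in these cases we have `D²(X) ≠ B²(X)`». [cite: MoonenZarhin1999LowDim, Thm. 0.1 (1)]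
[cite: Gordon1999HodgeAVSurvey, 9.2.2] -/
theorem exists_exceptional (hA : ∀ i, IsCMTypeRealisation (Φ i) (A i) (ι i) (θ i)) {m : ℕ}
    {T : Finset ((i : Fin n) × (K i →+* ℂ))} (hTm : T ∈ pohlmannSetsAlg Φ m) (hTD : T ∉ pohlmannDivisorSetsAlg Φ m) :
    ∃ c : complexBetti (⨁ A).X (2 * m), IsRationalClass c ∧ IsOfHodgeType (⨁ A).dim (⨁ A).X (2 * m) m m c ∧
        c ∉ divisorClassesSpan (⨁ A).X (⨁ A).dim m :=
  (exists_exceptional_biproduct_iff hA m).2 ⟨T, hTm, hTD⟩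

omit [∀ i, IsCMField (K i)] in
/-- Divisor classes and their products are algebraic on `⨁ A_i` (Lefschetz `(1,1)`, the tree's theorem). [cite: vanGeemen1994HodgeAV, §2.4] -/
theorem divisorClassesSpan_le_algebraicClasses' (q : ℕ) :
    divisorClassesSpan (⨁ A).X (⨁ A).dim q ≤ algebraicClasses (⨁ A).X q :=
  AbelianVariety.divisorClassesSpan_le_algebraicClasses (⨁ A)
    (fun b hb hb' => lefschetzOneOne_rational_holds (Motives.AbelianVariety.isSmoothProjective_holds (A := ⨁ A)) b hb hb') q

/-- **THE HODGE CONJECTURE FOR `⨁ A_i` FOLLOWS FROM THE ALGEBRAICITY OF THE RATIONAL `(m,m)` CLASSES OF ITS ONE WEIL PLANE**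
`W_k ⊗ ℂ = weilClassesOf (⨁ A) φ_a m d` (corank-`≤ 1` family, balanced Weil fibre; divisor classes are algebraic by Lefschetz `(1,1)` and
the tree's `hodgeConjectureFor_of_isDivisorWeilGenerated`).  The hypothesis `hW` — Weil's question for ONE abelian variety of Weil type
(van Geemen 1.1) — is NOT claimed. [cite: vanGeemen1994HodgeAV, Thm. 4.11, Thm. 6.12 and 1.1] [cite: MoonenZarhin1999LowDim, Thm. 0.1 (1)]
[cite: Gordon1999HodgeAVSurvey, 9.5] -/
theorem hodgeConjectureFor_of_weilClasses_algebraic (hrank : (∑ i, finrank ℚ (K i)) / 2 ≤ cmFamilyRank Φ)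
    (hA : ∀ i, IsCMTypeRealisation (Φ i) (A i) (ι i) (θ i)) (a : ∀ i, 𝓞 (K i)) {d : ℕ} (hd : 0 < d)
    (ha : ∀ i, a i * a i = -(d : 𝓞 (K i))) {m : ℕ} (hm : 0 < m) (hm4 : 4 * m = ∑ i, finrank ℚ (K i))
    (hTbal : IsGaloisBalancedAlg Φ (Finset.univ.filter
      (fun y : (i : Fin n) × (K i →+* ℂ) => y.2 ((a y.1 : 𝓞 (K y.1)) : K y.1) = Complex.I * (Real.sqrt d : ℂ))))
    (hW : ∀ c ∈ weilClassesOf (⨁ A) (biproduct.map fun i => ι i (a i)) m d, IsRationalClass c →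
      IsOfHodgeType (2 * m) (⨁ A).X (2 * m) m m c → c ∈ algebraicClasses (⨁ A).X m) :
    HodgeConjectureFor (⨁ A).dim (⨁ A).X :=
  hodgeConjectureFor_of_isDivisorWeilGenerated (isWeilType hA a hd ha hm hm4 hTbal)
    (isDivisorWeilGenerated hrank hA a hd ha hm hm4 hTbal) divisorClassesSpan_le_algebraicClasses' hW

/-- **Conversely the Hodge conjecture for `⨁ A_i` makes its Weil classes algebraic** (they are rational `(m,m)`-classes) — so for these
CM products `HC(⨁ A_i) ⟺` the rational Weil classes of `φ_a` are algebraic. [cite: vanGeemen1994HodgeAV, 1.1 and Thm. 6.12] -/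
theorem hodgeConjectureFor_iff_weilClasses_algebraic (hrank : (∑ i, finrank ℚ (K i)) / 2 ≤ cmFamilyRank Φ)
    (hA : ∀ i, IsCMTypeRealisation (Φ i) (A i) (ι i) (θ i)) (a : ∀ i, 𝓞 (K i)) {d : ℕ} (hd : 0 < d)
    (ha : ∀ i, a i * a i = -(d : 𝓞 (K i))) {m : ℕ} (hm : 0 < m) (hm4 : 4 * m = ∑ i, finrank ℚ (K i))
    (hTbal : IsGaloisBalancedAlg Φ (Finset.univ.filter
      (fun y : (i : Fin n) × (K i →+* ℂ) => y.2 ((a y.1 : 𝓞 (K y.1)) : K y.1) = Complex.I * (Real.sqrt d : ℂ)))) :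
    HodgeConjectureFor (⨁ A).dim (⨁ A).X ↔
      ∀ c ∈ weilClassesOf (⨁ A) (biproduct.map fun i => ι i (a i)) m d, IsRationalClass c →
        IsOfHodgeType (2 * m) (⨁ A).X (2 * m) m m c → c ∈ algebraicClasses (⨁ A).X m := by
  refine ⟨fun h c _ hcQ hcH => ?_, hodgeConjectureFor_of_weilClasses_algebraic hrank hA a hd ha hm hm4 hTbal⟩
  have hdim : (⨁ A).dim = 2 * m := by rw [dim_biproduct_eq hA]; omega
  have hcH' : IsOfHodgeType (⨁ A).dim (⨁ A).X (2 * m) m m c := by rw [hdim]; exact hcH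
  exact h.2 m c hcQ hcH'

end Geometry

/-! ## §5 Two factors: the statements on `A₀ × A₁` -/

section TwoFactors

variable {K : Fin 2 → Type} [∀ i, Field (K i)] [∀ i, NumberField (K i)] [∀ i, IsCMField (K i)]
  {Φ : ∀ i, CMType (K i)} {A : Fin 2 → AbelianVariety ℂ} {ι : ∀ i, 𝓞 (K i) →+* End (A i)}
  {θ : ∀ i, K i →+* Module.End ℂ (complexBetti (A i).X 1)}

/-- **The Hodge conjecture for the PRODUCT `A₀ × A₁` from the algebraicity of the Weil plane of `(A₀ × A₁, ι₀(a₀) × ι₁(a₁))`**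
(Moonen–Zarhin's (a): `X = E × T`; transport along `A₀ × A₁ ≅ ⨁_{i<2} A_i`, `PairWeights.weilClassesOf_biproduct_le_algebraicClasses_of_prod`,
`PairWeights.hodgeConjectureFor_prod_of_biproduct`). [cite: MoonenZarhin1999LowDim, Thm. 0.1 (a) and (1)] [cite: vanGeemen1994HodgeAV, 3.6–3.7] -/
theorem hodgeConjectureFor_prod_of_weilClasses_algebraic (hrank : (∑ i, finrank ℚ (K i)) / 2 ≤ cmFamilyRank Φ)
    (hA : ∀ i, IsCMTypeRealisation (Φ i) (A i) (ι i) (θ i)) (a : ∀ i, 𝓞 (K i)) {d : ℕ} (hd : 0 < d)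
    (ha : ∀ i, a i * a i = -(d : 𝓞 (K i))) {m : ℕ} (hm : 0 < m) (hm4 : 4 * m = ∑ i, finrank ℚ (K i))
    (hTbal : IsGaloisBalancedAlg Φ (Finset.univ.filter
      (fun y : (i : Fin 2) × (K i →+* ℂ) => y.2 ((a y.1 : 𝓞 (K y.1)) : K y.1) = Complex.I * (Real.sqrt d : ℂ))))
    (hW : weilClassesOf ((A 0).prod (A 1))
        (Motives.AbelianVariety.prodLift (Motives.AbelianVariety.fst (A 0) (A 1) ≫ ι 0 (a 0))
          (Motives.AbelianVariety.snd (A 0) (A 1) ≫ ι 1 (a 1))) m d ≤ algebraicClasses ((A 0).prod (A 1)).X m) :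
    HodgeConjectureFor ((A 0).prod (A 1)).dim ((A 0).prod (A 1)).X :=
  hodgeConjectureFor_prod_of_biproduct
    (hodgeConjectureFor_of_weilClasses_algebraic hrank hA a hd ha hm hm4 hTbal fun _ hc _ _ =>
      weilClassesOf_biproduct_le_algebraicClasses_of_prod (fun i => ι i (a i)) hW hc)

end TwoFactors

end CorankOne

end CMAlgebra

end Literature.AlgebraicGeometry.Pohlmann1968

end
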